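import Summits.ABC.IUTFork.Thm311RealInd1Strip
import Summits.ABC.IUTFork.Thm311RealInd2IsmRigid
import Summits.ABC.IUTFork.Thm311RealIsmDHUnramified
import Summits.ABC.IUTFork.Thm311RealLog
import Literature.AnabelianGeometry.AbsoluteAnabelian.MonoAnalyticLiftNormCompat
import HarnessLib

/-!
# [IUTchIII] Theorem 3.11 (i) (Ind1), print-literal at `v ∈ 𝕍^non`: at a place of LOCAL DEGREE ONE (`K_v = ℚ_{p_v}`)
# print's (Ind1) strip part is TRIVIAL — `Real.ind1StripOf v L = {1}`

Record file (D-0012) of the abc-iut cell (seat abc-iut-c312-1, holder of record of the typed [IUTchIII] Thm. 3.11, gen 8);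
sequel of `Thm311RealInd1Strip.lean`.  TAKES NO SIDE on [IUTchIII] Cor. 3.12.

THE POINT.  Dupuy–Hilado (§4.7) type (Ind1) as the capsule-index permutations only — strip slot `Real.stripAutDH = {1}`;
print ([IUTchIII] Thm. 3.11 (i) (Ind1), kurims p. 154 l. 52–54) lets the automorphisms of the `𝒟⊢`-prime-strips act, at
`v ∈ 𝕍^non` through THE equivariant lift of `φ ∈ Aut_top(G_v)` to `O^×(G_v)` and its restriction `Real.liftUnits v φ` to
`𝒪_v^×` (`Thm311RealInd1Strip`).  By NORM RIGIDITY (abc-iut-w6-d012's `MLFClosure.norm_liftM_eq_std`, [AbsAnab] Prop. 1.2.1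
(iii)/(vi) + `χ_cyc ∘ Art = N⁻¹`; [IUTchII] Rmk. 1.8.1) `N_{K_v/ℚ_p} ∘ liftUnits v φ = N_{K_v/ℚ_p}`; when `n_v = [K_v : ℚ_p] = 1`
the norm is injective, so **`liftUnits v φ = 1` for EVERY `φ`**, every realised strip automorphism fixes `L(𝒪_v^×)`
pointwise, and (bicontinuity ⇒ `ℚ_p`-linearity on the line `K_v = ℚ_p·1`) **`Real.ind1StripOf v L = {1}`** for every
non-degenerate `L` — e.g. abc-iut-c312-5's canonical analytic logarithm `Real.analyticLogv F v`
(`Real.ind1StripOf_analyticLogv_eq_singleton_of_localDeg_eq_one`).  So AT EVERY PLACE OF LOCAL DEGREE ONE (every place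
over a prime that splits completely in `F`; every finite place when the completions are `ℚ_p`) print's (Ind1) strip slot
COINCIDES with Dupuy–Hilado's trivialised one: there the two readings of (Ind1) differ by NOTHING.

PROVED (ns `Summit.ABC.IUTFork.Thm311.Real`; `localDeg F v = e_v f_v`, abc-iut-S7's `Literature.NumberTheory.NumberFields.localDeg`):
`norm_liftUnits_of_mem` (norm rigidity for any prime `p` under `v`, canonical `ℚ_p`-structure
`LocalField.adicCompletionPadicAlgebra`), **`liftUnits_eq_self_of_localDeg_eq_one`**, `realises_iff_forall_eq_of_localDeg_eq_one`,
`exists_ne_zero_of_integersSubsetLogShell` (a law-abiding `L` is non-degenerate: `L u = p^*` for some `u`),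
**`eq_refl_of_mem_ind1StripOf_of_localDeg_eq_one`**, **`ind1StripOf_eq_singleton_of_localDeg_eq_one`**,
`ind1StripOf_analyticLogv_eq_singleton_of_localDeg_eq_one`.

HONEST SCOPE: statements about OUR typed objects; at places of local degree `> 1` print's strip part is in general
NON-trivial (it contains the realisations of valuation-preserving field automorphisms of `K_v` — not typed here) but still
norm-rigid (`Thm311RealInd1StripRigid`) and inside DH's `Aut_{ℚ_p}(K_v : I_v)` (`Thm311RealInd1StripSignature`).
Nothing here asserts or refutes [IUTchIII] Cor. 3.12; no side taken.  [claim: Mochizuki2012, status: disputed] for the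
quotations; [cite: MochizukiAbsAnab2004, Prop 1.2.1 (vi) p.10]; [cite: DupuyHilado2025, §4.7]. typed ≠ proved elsewhere.
-/

set_option autoImplicit false

noncomputable section

namespace Summit.ABC.IUTFork.Thm311.Real

open NumberField IsDedekindDomain Literature.IUT.LogVolume Literature.IUT.LogThetaLattice
open Literature.AnabelianGeometry.AbsoluteAnabelian Literature.IUT.HodgeArakelov
open Literature.IUT.HodgeArakelov.AbsTopMonoids
open Literature.NumberTheory.GaloisRepresentations Literature.NumberTheory.NumberFields

variable {F : Type} [Field F] [NumberField F] (v : HeightOneSpectrum (𝓞 F))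

/-! ## 1. Norm rigidity for any prime under `v` (canonical `ℚ_p`-structure `adicCompletionPadicAlgebra`) -/

/-- **`N_{K_v/ℚ_p}(liftUnits v φ u) = N_{K_v/ℚ_p}(u)`** for the canonical `ℚ_p`-algebra structure of `K_v` at a prime `p`
under `v` (the tree's `LocalField.adicCompletionPadicAlgebra v p hv`) — abc-iut-w6-d012's `MLFClosure.norm_liftM_eq_std`
read on `Real.liftUnits`. [cite: MochizukiAbsAnab2004, Prop 1.2.1 (vi) p.10] -/
theorem norm_liftUnits_of_mem (p : ℕ) [Fact p.Prime] (hv : ((p : ℕ) : 𝓞 F) ∈ v.asIdeal)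
    (φ : Gal v ≃ₜ* Gal v) (u : (↥(v.adicCompletionIntegers F))ˣ) :
    letI := LocalField.adicCompletionPadicAlgebra v p hv
    Algebra.norm ℚ_[p] ((liftUnits v φ u : ↥(v.adicCompletionIntegers F)) : v.adicCompletion F) =
      Algebra.norm ℚ_[p] ((u : ↥(v.adicCompletionIntegers F)) : v.adicCompletion F) := by
  haveI : CharZero (v.adicCompletion F) := charZero_adicCompletion v
  have hval := val_toOUnits v u
  have hu : algebraMap (v.adicCompletion F) (AlgebraicClosure (v.adicCompletion F))
      ((u : ↥(v.adicCompletionIntegers F)) : v.adicCompletion F) ∈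
        nonzeroIntegers (v.adicCompletion F) (AlgebraicClosure (v.adicCompletion F)) := by
    rw [← hval]
    exact ((toOUnits v u : OUnits v) :
      nonzeroIntegers (v.adicCompletion F) (AlgebraicClosure (v.adicCompletion F))).2
  have harg : ((toOUnits v u : OUnits v) :
      nonzeroIntegers (v.adicCompletion F) (AlgebraicClosure (v.adicCompletion F))) = ⟨_, hu⟩ :=
    Subtype.ext hval
  have heq : ((Genuine.liftM (closureAt v) φ ⟨_, hu⟩ :
      nonzeroIntegers (v.adicCompletion F) (AlgebraicClosure (v.adicCompletion F))) :
        AlgebraicClosure (v.adicCompletion F)) =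
      algebraMap (v.adicCompletion F) (AlgebraicClosure (v.adicCompletion F))
        ((liftUnits v φ u : ↥(v.adicCompletionIntegers F)) : v.adicCompletion F) := by
    rw [← harg, ← coe_stripLift, stripLift_toOUnits]
    exact val_toOUnits v (liftUnits v φ u)
  exact MLFClosure.norm_liftM_eq_std (v.adicCompletion F) p (LocalField.valuation_adicCompletion_natCast_lt_one v p hv)
    φ _ _
    hu (valuation_coe_unit v u) heq

/-! ## 2. Local degree one: THE lift acts trivially on `𝒪_v^×` -/

/-- In local degree one every element of `K_v` is the image of its norm: `K_v = ℚ_p · 1` and `N(c · 1) = c`. [folklore] -/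
theorem algebraMap_norm_eq_self_of_localDeg_eq_one (p : ℕ) [Fact p.Prime] (hv : ((p : ℕ) : 𝓞 F) ∈ v.asIdeal)
    (hdeg : localDeg F v = 1) (y : v.adicCompletion F) :
    letI := LocalField.adicCompletionPadicAlgebra v p hv
    algebraMap ℚ_[p] (v.adicCompletion F) (Algebra.norm ℚ_[p] y) = y := by
  letI := LocalField.adicCompletionPadicAlgebra v p hv
  have hfin : Module.finrank ℚ_[p] (v.adicCompletion F) = 1 :=
    (RescaledCompletion.localDeg_eq_finrank F p v hv).symm.trans hdeg
  obtain ⟨c, rfl⟩ := (finrank_eq_one_iff_of_nonzero' (1 : v.adicCompletion F) one_ne_zero).mp hfin y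
  rw [Algebra.smul_def, mul_one, Algebra.norm_algebraMap, hfin, pow_one]

/-- **At a place of local degree one, THE lift of EVERY `φ ∈ Aut_top(G_v)` acts trivially on `𝒪_v^×`:
`liftUnits v φ u = u`** (norm rigidity + injectivity of `N_{ℚ_p/ℚ_p}`). [cite: MochizukiAbsAnab2004, Prop 1.2.1 (vi) p.10] -/
theorem liftUnits_eq_self_of_localDeg_eq_one (hdeg : localDeg F v = 1) (φ : Gal v ≃ₜ* Gal v)
    (u : (↥(v.adicCompletionIntegers F))ˣ) : liftUnits v φ u = u := by
  haveI : Fact (residueChar F v).Prime := ⟨residueChar_prime F v⟩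
  have hv := natCast_residueChar_mem F v
  apply Units.ext; apply Subtype.ext
  rw [← algebraMap_norm_eq_self_of_localDeg_eq_one v (residueChar F v) hv hdeg
      ((liftUnits v φ u : ↥(v.adicCompletionIntegers F)) : v.adicCompletion F),
    norm_liftUnits_of_mem v (residueChar F v) hv φ u, algebraMap_norm_eq_self_of_localDeg_eq_one v (residueChar F v) hv hdeg]

/-- So the strip automorphism `stripMulAut v φ` fixes the class of every `u ∈ 𝒪_v^×`. [claim: Mochizuki2012, status: disputed] -/
theorem stripMulAut_clsOf_of_localDeg_eq_one (hdeg : localDeg F v = 1) (φ : Gal v ≃ₜ* Gal v)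
    (u : (↥(v.adicCompletionIntegers F))ˣ) : stripMulAut v φ (clsOf v u) = clsOf v u := by
  rw [stripMulAut_clsOf, liftUnits_eq_self_of_localDeg_eq_one v hdeg]

section Realisation

variable (L : Additive (↥(v.adicCompletionIntegers F))ˣ →+ v.adicCompletion F)

/-- **At local degree one, `ψ` realises a strip automorphism iff it fixes the log-lattice `L(𝒪_v^×)` pointwise.**
[claim: Mochizuki2012, status: disputed] -/
theorem realises_iff_forall_eq_of_localDeg_eq_one (hdeg : localDeg F v = 1) (φ : Gal v ≃ₜ* Gal v)
    (ψ : v.adicCompletion F ≃+ v.adicCompletion F) :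
    Realises v L (stripMulAut v φ) ψ ↔
      ∀ u : (↥(v.adicCompletionIntegers F))ˣ, ψ (L (Additive.ofMul u)) = L (Additive.ofMul u) := by
  rw [realises_stripMulAut_iff]
  refine forall_congr' fun u => ?_
  rw [liftUnits_eq_self_of_localDeg_eq_one v hdeg]

/-- A law-abiding logarithm (`𝒪_v ⊆ I_v = (p^*)⁻¹ · L(𝒪_v^×)`, abc-iut-L6-t3's `IntegersSubsetLogShell`) is NON-DEGENERATE:
`L u = p^* ≠ 0` for some unit `u` (`1 ∈ 𝒪_v ⊆ I_v`). [claim: Mochizuki2012, status: disputed] -/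
theorem exists_ne_zero_of_integersSubsetLogShell {p : ℕ}
    (hlaw : IntegersSubsetLogShell (v.adicCompletionIntegers F) L p) :
    ∃ u : (↥(v.adicCompletionIntegers F))ˣ, L (Additive.ofMul u) ≠ 0 := by
  haveI : CharZero (v.adicCompletion F) := charZero_adicCompletion v
  obtain ⟨u, hu⟩ := hlaw.subset (v.adicCompletionIntegers F).one_mem
  refine ⟨u, fun h0 => ?_⟩
  rw [h0, mul_zero] at hu
  exact one_ne_zero hu

/-- **At a place of local degree one every element of print's (Ind1) strip part is the IDENTITY of `K_v`** (for a
non-degenerate logarithm `L`): it fixes `L(𝒪_v^×) ∋ a₀ ≠ 0` pointwise and, being bicontinuous and additive, is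
`ℚ_p`-linear on the `ℚ_p`-line `K_v` (abc-iut-w5-d216's `IsmDHUnram.map_smul_of_continuous`).
[claim: Mochizuki2012, status: disputed] -/
theorem eq_refl_of_mem_ind1StripOf_of_localDeg_eq_one (hdeg : localDeg F v = 1)
    (hL : ∃ u : (↥(v.adicCompletionIntegers F))ˣ, L (Additive.ofMul u) ≠ 0)
    {ψ : v.adicCompletion F ≃+ v.adicCompletion F} (hψ : ψ ∈ ind1StripOf v L) :
    ψ = AddEquiv.refl (v.adicCompletion F) := by
  obtain ⟨hc, -, φ, hr⟩ := hψ
  rw [realises_iff_forall_eq_of_localDeg_eq_one v L hdeg] at hr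
  obtain ⟨u₁, hu₁⟩ := hL
  haveI : Fact (residueChar F v).Prime := ⟨residueChar_prime F v⟩
  have hv := natCast_residueChar_mem F v
  -- read `ψ` on the rescaled completion `K` (a normed `ℚ_p`-algebra, the same type underneath)
  set K := RescaledCompletion F (residueChar F v) v hv with hK
  let e : v.adicCompletion F ≃+* K := RescaledCompletion.of F (residueChar F v) v hv
  let f : K →+ K := (e.symm.toAddEquiv.trans (ψ.trans e.toAddEquiv)).toAddMonoidHom
  have hf : ∀ a : v.adicCompletion F, f (e a) = e (ψ a) := fun a => by
    change e (ψ (e.symm (e a))) = e (ψ a)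
    rw [RingEquiv.symm_apply_apply]
  have hfc : Continuous f := hc
  -- `K` is a line over `ℚ_p`
  have hfin : Module.finrank ℚ_[residueChar F v] K = 1 :=
    (RescaledCompletion.localDeg_eq_finrank F (residueChar F v) v hv).symm.trans hdeg
  have hspan : ∀ y : K, ∃ c : ℚ_[residueChar F v], c • (1 : K) = y :=
    (finrank_eq_one_iff_of_nonzero' (1 : K) one_ne_zero).mp hfin
  -- `f` fixes the non-zero vector `e (L u₁)`, hence `f 1 = 1`
  have hfix : f (e (L (Additive.ofMul u₁))) = e (L (Additive.ofMul u₁)) := by rw [hf, hr u₁]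
  obtain ⟨c₁, hc₁⟩ := hspan (e (L (Additive.ofMul u₁)))
  have hc₁0 : c₁ ≠ 0 := by
    rintro rfl
    rw [zero_smul] at hc₁
    exact hu₁ (e.injective (by rw [map_zero]; exact hc₁.symm))
  have hf1 : f 1 = 1 := by
    rw [← hc₁, IsmDHUnram.map_smul_of_continuous f hfc] at hfix
    exact smul_right_injective K hc₁0 hfix
  -- hence `f = id`, i.e. `ψ = id`
  have hfy : ∀ y : K, f y = y := fun y => by
    obtain ⟨c, rfl⟩ := hspan y
    rw [IsmDHUnram.map_smul_of_continuous f hfc, hf1]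
  apply AddEquiv.ext
  intro a
  apply e.injective
  rw [← hf, hfy]
  rfl

/-- **`Real.ind1StripOf v L = {1}` at a place of local degree one**, for every non-degenerate `L`.
[claim: Mochizuki2012, status: disputed] -/
theorem ind1StripOf_eq_singleton_of_localDeg_eq_one (hdeg : localDeg F v = 1)
    (hL : ∃ u : (↥(v.adicCompletionIntegers F))ˣ, L (Additive.ofMul u) ≠ 0) :
    ind1StripOf v L = {AddEquiv.refl (v.adicCompletion F)} := by
  ext ψ
  rw [Set.mem_singleton_iff]
  exact ⟨eq_refl_of_mem_ind1StripOf_of_localDeg_eq_one v L hdeg hL, fun h => h ▸ refl_mem_ind1StripOf v L⟩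

/-- The same for a LAW-ABIDING `L` (`𝒪_v ⊆ I_v`). [claim: Mochizuki2012, status: disputed] -/
theorem ind1StripOf_eq_singleton_of_localDeg_eq_one_of_law (hdeg : localDeg F v = 1) {p : ℕ}
    (hlaw : IntegersSubsetLogShell (v.adicCompletionIntegers F) L p) :
    ind1StripOf v L = {AddEquiv.refl (v.adicCompletion F)} :=
  ind1StripOf_eq_singleton_of_localDeg_eq_one v L hdeg (exists_ne_zero_of_integersSubsetLogShell v L hlaw)

end Realisation

/-! ## 3. On abc-iut-c312-5's canonical binder: the analytic logarithm -/

/-- **`Real.ind1StripOf v (analyticLogv F v) = {1}` at every place of local degree one** — for abc-iut-c312-5's CANONICAL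
analytic logarithm (law-abiding: `Real.logvLaw_analyticLogv`).  At such places print's (Ind1) strip slot coincides with
Dupuy–Hilado's trivialised `Real.stripAutDH = {1}` (§4.7): the two readings of (Ind1) differ by nothing there.
[cite: DupuyHilado2025, §4.7] [claim: Mochizuki2012, status: disputed] -/
theorem ind1StripOf_analyticLogv_eq_singleton_of_localDeg_eq_one (hdeg : localDeg F v = 1) :
    ind1StripOf v (analyticLogv F v) = {AddEquiv.refl (v.adicCompletion F)} :=
  ind1StripOf_eq_singleton_of_localDeg_eq_one_of_law v (analyticLogv F v) hdeg (logvLaw_analyticLogv F v)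

end Summit.ABC.IUTFork.Thm311.Real

end
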